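import Literature.AnabelianGeometry.SemiGraphs.TemperedVerticialInjective
import HarnessLib

/-!
# [SemiAnbd] §2–§3: coverings of a semi-graph of anabelioids glued from free local data over an
# approximator (the construction in the proofs of Propositions 2.5 and 2.6)

Mochizuki, *Semi-graphs of anabelioids*, Publ. RIMS **42** (2006), §2, manuscript pp. 27–29
[cite: MochizukiSemiAnbd2006, Prop 2.6 p.28]: the proofs of Proposition 2.5 (i)/(ii) and of
Proposition 2.6 construct "[not necessarily connected!] finite étale covering[s] … by gluing": over
each constituent `G_c` one prescribes a finite covering pulled back from the approximator `G'`
(p. 27: unions of copies of the universal covering of `G'_c`; p. 28: over the distinguished vertex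
`v`, "a union of `M'/2[Π'_v : N_M]` copies of the covering defined by the `Π'_v`-set `Π'_v/N_M` and of
`M'/2[Π'_v : 1]` copies of a 'universal covering' of `G'_v`"), observes that "the restriction of any
of these coverings over `w` or `v` to an abutting edge `e` is isomorphic to a union of 'universal
coverings' of `G'_e`" — i.e. is a FREE `Π'_e`-set of the right cardinality — and concludes "thus, by
choosing appropriate gluing isomorphisms, we obtain a covering".

This file renders that construction once and for all in the local presentation of
`TemperedCoverings.lean` (sequel of `TemperedVerticialInjective.lean`, whose `Approximator.trivCov` is
the special case "all constituents universal"): `Approximator.GluingData A` = finite `Π'_c`-sets `X_c`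
for every component, free over the edge groups (for the edge constituents: free; for a vertex
constituent: free under every conjugate of every `b'_*(Π'_e)`, `b` a branch abutting to the vertex)
and of matching cardinalities along the branches; `GluingData.cov` = the glued object of `B^cov(G)`
(`Π_c` acting through `Π_c → Π'_c`), which is finite and TEMPERED (split by `A.trivCov`).
Plain bookkeeping over [SemiAnbd]'s construction; no statement of the paper is involved.
-/

open CategoryTheory Topology

namespace Literature.AnabelianGeometry.SemiGraphs

universe u

/-! ### Two tools -/

section Tools

open scoped Pointwise

variable {G : Type u} [Group G] [TopologicalSpace G] [IsTopologicalGroup G]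

/-- A homomorphism with open kernel to a discrete group pulls every subset back to an open set.
[folklore] -/
private theorem isOpen_preimage_of_isOpen_ker {F : Type*} [Group F] (π : G →* F)
    (hπ : IsOpen (π.ker : Set G)) (S : Set F) : IsOpen (π ⁻¹' S) := by
  have : π ⁻¹' S = (π ⁻¹' S) * (π.ker : Set G) := by
    ext x
    constructor
    · intro hx
      exact ⟨x, hx, 1, π.ker.one_mem, mul_one x⟩
    · rintro ⟨a, ha, k, hk, rfl⟩
      simp only [Set.mem_preimage, map_mul, (MonoidHom.mem_ker).mp hk, mul_one]
      exact ha
  rw [this]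
  exact hπ.mul_left

end Tools

section FreeActions

variable {F : Type*} [Group F] {X : Type*} [MulAction F X]

open MulAction in
/-- For a free action, `(ω, f) ↦ f • ω.out` is a bijection from (orbit space) `× F` onto `X`.
[folklore] -/
private theorem bijective_smul_out' (hfree : ∀ (f : F) (x : X), f • x = x → f = 1) :
    Function.Bijective fun p : orbitRel.Quotient F X × F => p.2 • p.1.out := by
  constructor
  · rintro ⟨ω₁, f₁⟩ ⟨ω₂, f₂⟩ h
    dsimp only at h
    have hω : ω₁ = ω₂ := by
      rw [← Quotient.out_eq ω₁, ← Quotient.out_eq ω₂]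
      refine Quotient.sound ?_
      change ω₁.out ∈ MulAction.orbit F ω₂.out
      refine ⟨f₁⁻¹ * f₂, ?_⟩
      simp only [mul_smul, ← h, inv_smul_smul]
    subst hω
    have hfix : (f₂⁻¹ * f₁) • ω₁.out = ω₁.out := by rw [mul_smul, h, inv_smul_smul]
    have := hfree _ _ hfix
    rw [inv_mul_eq_one] at this
    rw [this]
  · intro x
    have hx : (Quotient.mk (orbitRel F X) x).out ∈ MulAction.orbit F x :=
      Quotient.exact (Quotient.out_eq (Quotient.mk (orbitRel F X) x))
    obtain ⟨f, hf⟩ := hx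
    refine ⟨(Quotient.mk (orbitRel F X) x, f⁻¹), ?_⟩
    dsimp only
    rw [← hf, inv_smul_smul]

open MulAction in
/-- For a free action of a finite group on a finite set, `|X| = |X/F| · |F|`. [folklore] -/
private theorem card_eq_card_quotient_mul' (hfree : ∀ (f : F) (x : X), f • x = x → f = 1) :
    Nat.card X = Nat.card (orbitRel.Quotient F X) * Nat.card F := by
  rw [← Nat.card_prod]
  exact (Nat.card_congr (Equiv.ofBijective _ (bijective_smul_out' hfree))).symm

/-- Two finite free `F`-sets of the same cardinality are `F`-isomorphic. [folklore] -/
private theorem exists_equivariant_equiv_of_free' [Finite F] {Y : Type*} [MulAction F Y]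
    [Finite X] [Finite Y]
    (hX : ∀ (f : F) (x : X), f • x = x → f = 1) (hY : ∀ (f : F) (y : Y), f • y = y → f = 1)
    (hcard : Nat.card X = Nat.card Y) :
    ∃ e : X ≃ Y, ∀ (f : F) (x : X), e (f • x) = f • e x := by
  classical
  let eX := Equiv.ofBijective _ (bijective_smul_out' hX)
  let eY := Equiv.ofBijective _ (bijective_smul_out' hY)
  have hq : Nat.card (MulAction.orbitRel.Quotient F X) =
      Nat.card (MulAction.orbitRel.Quotient F Y) := by
    have h1 := card_eq_card_quotient_mul' hX
    have h2 := card_eq_card_quotient_mul' hY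
    have hF : 0 < Nat.card F := Nat.card_pos
    rw [hcard, h2] at h1
    exact (Nat.eq_of_mul_eq_mul_right hF h1).symm
  haveI : Finite (MulAction.orbitRel.Quotient F X) := Quotient.finite _
  haveI : Finite (MulAction.orbitRel.Quotient F Y) := Quotient.finite _
  obtain ⟨σ⟩ := Finite.card_eq.mp hq
  refine ⟨eX.symm.trans ((σ.prodCongr (Equiv.refl F)).trans eY), fun f x => ?_⟩
  obtain ⟨⟨ω, f₀⟩, rfl⟩ := eX.surjective x
  have h1 : f • eX (ω, f₀) = eX (ω, f * f₀) := by
    simp only [eX, Equiv.ofBijective_apply, mul_smul]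
  rw [h1, Equiv.trans_apply, Equiv.trans_apply, Equiv.symm_apply_apply, Equiv.trans_apply,
    Equiv.trans_apply, Equiv.symm_apply_apply]
  simp only [eY, Equiv.prodCongr_apply, Prod.map, Equiv.refl_apply, Equiv.ofBijective_apply,
    mul_smul]

end FreeActions

namespace ProfiniteSemiGraph

variable {𝒢 : ProfiniteSemiGraph.{u}}

namespace Approximator

variable (A : 𝒢.Approximator)

/-- **Gluing data over an approximator** `G → G'` (proofs of Prop. 2.5/2.6, pp. 27–28): for every
vertex `w` and edge `e` a finite `Π'_w`-set `X_w` / `Π'_e`-set `X_e` (the prescribed covering of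
`G'_c`, pulled back to `G_c`), such that "the restriction … to an abutting edge `e` is isomorphic to a
union of universal coverings of `G'_e`": `X_e` is a free `Π'_e`-set, `X_w` is free under every
conjugate of `b'_*(Π'_e)` for every branch `b` of `e` abutting to `w`, and the cardinalities along
the branches agree. [cite: MochizukiSemiAnbd2006, Prop 2.6 p.28] -/
structure GluingData : Type (u + 1) where
  /-- the `Π'_w`-sets over the vertices -/
  XV : 𝒢.graph.Vertex → Type u
  /-- the `Π'_e`-sets over the edges -/
  XE : 𝒢.graph.Edge → Type u
  [actV : ∀ w, MulAction (A.FV w) (XV w)]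
  [actE : ∀ e, MulAction (A.FE e) (XE e)]
  [finiteV : ∀ w, Finite (XV w)]
  [finiteE : ∀ e, Finite (XE e)]
  /-- the edge sets are free -/
  free_E : ∀ (e : 𝒢.graph.Edge) (f : A.FE e) (y : XE e), f • y = y → f = 1
  /-- the vertex sets are free under the conjugates of the branch images of the edge groups -/
  free_br : ∀ (b : 𝒢.graph.Branch) (v : 𝒢.graph.Vertex) (h : 𝒢.graph.abuts b = some v)
    (g : A.FV v) (f : A.FE (𝒢.graph.edgeOf b)) (x : XV v),
    (g * A.brF b v h f * g⁻¹) • x = x → f = 1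
  /-- matching cardinalities along the branches -/
  card_br : ∀ (b : 𝒢.graph.Branch) (v : 𝒢.graph.Vertex), 𝒢.graph.abuts b = some v →
    Nat.card (XE (𝒢.graph.edgeOf b)) = Nat.card (XV v)

namespace GluingData

attribute [instance] GluingData.actV GluingData.actE GluingData.finiteV GluingData.finiteE

variable {A} (D : A.GluingData)

/-- The `w`-constituent of the glued covering: `X_w` with `Π_w` acting through `Π_w → Π'_w` —
countable (finite) with open stabilisers (unions of cosets of the open kernel).
[cite: MochizukiSemiAnbd2006, Prop 2.6 p.28] -/
noncomputable def objV (w : 𝒢.graph.Vertex) : BTemp (𝒢.Gv w) :=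
  ⟨@Action.ofMulAction (𝒢.Gv w) (D.XV w) _ (MulAction.compHom (D.XV w) (A.πV w)), by
    refine ⟨inferInstanceAs (Countable (D.XV w)), fun x => ?_⟩
    change D.XV w at x
    have : {γ : 𝒢.Gv w | (@Action.ofMulAction (𝒢.Gv w) (D.XV w) _
        (MulAction.compHom (D.XV w) (A.πV w))).ρ γ x = x} =
        A.πV w ⁻¹' {f : A.FV w | f • x = x} := by
      ext γ
      rfl
    rw [this]
    exact isOpen_preimage_of_isOpen_ker (A.πV w) (A.isOpen_ker_πV w) _⟩

/-- The `e`-constituent of the glued covering. [cite: MochizukiSemiAnbd2006, Prop 2.6 p.28] -/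
noncomputable def objE (e : 𝒢.graph.Edge) : BTemp (𝒢.Ge e) :=
  ⟨@Action.ofMulAction (𝒢.Ge e) (D.XE e) _ (MulAction.compHom (D.XE e) (A.πE e)), by
    refine ⟨inferInstanceAs (Countable (D.XE e)), fun x => ?_⟩
    change D.XE e at x
    have : {γ : 𝒢.Ge e | (@Action.ofMulAction (𝒢.Ge e) (D.XE e) _
        (MulAction.compHom (D.XE e) (A.πE e))).ρ γ x = x} =
        A.πE e ⁻¹' {f : A.FE e | f • x = x} := by
      ext γ
      rfl
    rw [this]
    exact isOpen_preimage_of_isOpen_ker (A.πE e) (A.isOpen_ker_πE e) _⟩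

/-- The action on the `w`-constituent: through `Π_w → Π'_w`. [cite: MochizukiSemiAnbd2006, Prop 2.6 p.28] -/
theorem objV_ρ (w : 𝒢.graph.Vertex) (γ : 𝒢.Gv w) (x : D.XV w) :
    (D.objV w).obj.ρ γ x = A.πV w γ • x := rfl

/-- The action on the `e`-constituent: through `Π_e → Π'_e`. [cite: MochizukiSemiAnbd2006, Prop 2.6 p.28] -/
theorem objE_ρ (e : 𝒢.graph.Edge) (γ : 𝒢.Ge e) (x : D.XE e) :
    (D.objE e).obj.ρ γ x = A.πE e γ • x := rfl

/-- "By choosing appropriate gluing isomorphisms" (pp. 27, 28): along a branch `b` of `e` abutting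
to `v`, `X_e` and `b^* X_v` are free `Π'_e`-sets (`Π'_e` acting on `X_v` through `γ_{g⁻¹} ∘ b'_*`,
`g` the 2-cell of the approximator at `b`) of the same cardinality, hence `Π'_e`-, hence
`Π_e`-isomorphic. [cite: MochizukiSemiAnbd2006, Prop 2.6 p.28] -/
theorem exists_glueEquiv (b : 𝒢.graph.Branch) (v : 𝒢.graph.Vertex)
    (h : 𝒢.graph.abuts b = some v) :
    ∃ e : (D.objE (𝒢.graph.edgeOf b)).obj.V ≃
        ((BTemp.res (𝒢.brHom b v h)).obj (D.objV v)).obj.V,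
      ∀ (x : 𝒢.Ge (𝒢.graph.edgeOf b)) (p : (D.objE (𝒢.graph.edgeOf b)).obj.V),
        e ((D.objE (𝒢.graph.edgeOf b)).obj.ρ x p) =
          ((BTemp.res (𝒢.brHom b v h)).obj (D.objV v)).obj.ρ x (e p) := by
  classical
  obtain ⟨g, hg⟩ := A.comm b v h
  -- `Π'_e` acting on `X_v` through `f ↦ g⁻¹ b'_*(f) g`
  let θ : A.FE (𝒢.graph.edgeOf b) →* A.FV v :=
    (MulAut.conj g⁻¹).toMonoidHom.comp (A.brF b v h)
  have hθ : ∀ f, θ f = g⁻¹ * A.brF b v h f * g⁻¹⁻¹ := fun f => by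
    simp [θ]
  letI iY : MulAction (A.FE (𝒢.graph.edgeOf b)) (D.XV v) := MulAction.compHom (D.XV v) θ
  have hX : ∀ (f : A.FE (𝒢.graph.edgeOf b)) (p : D.XE (𝒢.graph.edgeOf b)), f • p = p → f = 1 :=
    D.free_E _
  have hY : ∀ (f : A.FE (𝒢.graph.edgeOf b)) (p : D.XV v), f • p = p → f = 1 := fun f p hp => by
    change θ f • p = p at hp
    rw [hθ] at hp
    exact D.free_br b v h g⁻¹ f p hp
  obtain ⟨e, he⟩ := exists_equivariant_equiv_of_free' hX hY (D.card_br b v h)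
  refine ⟨e, fun x p => ?_⟩
  change D.XE (𝒢.graph.edgeOf b) at p
  change e (A.πE _ x • p) = A.πV v (𝒢.brHom b v h x) • e p
  rw [he]
  change θ (A.πE _ x) • e p = _
  rw [hθ, hg]
  simp only [inv_inv, mul_assoc, inv_mul_cancel_left, inv_mul_cancel, mul_one]

/-- A chosen gluing isomorphism along `b`. [cite: MochizukiSemiAnbd2006, Prop 2.6 p.28] -/
noncomputable def glue (b : 𝒢.graph.Branch) (v : 𝒢.graph.Vertex)
    (h : 𝒢.graph.abuts b = some v) :
    D.objE (𝒢.graph.edgeOf b) ≅ (BTemp.res (𝒢.brHom b v h)).obj (D.objV v) :=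
  BTemp.isoOfEquiv (D.exists_glueEquiv b v h).choose (D.exists_glueEquiv b v h).choose_spec

/-- **The glued covering** of `G` determined by gluing data over an approximator (pp. 27–28): an
object of `B^cov(G)`. [cite: MochizukiSemiAnbd2006, Prop 2.6 p.28] -/
noncomputable def cov : CovObj 𝒢 where
  SV w := D.objV w
  SE e := D.objE e
  glue b v h := D.glue b v h

/-- The glued covering is finite. [cite: MochizukiSemiAnbd2006, Prop 2.6 p.28] -/
theorem cov_isFinite : D.cov.IsFinite :=
  ⟨fun w => inferInstanceAs (Finite (D.XV w)), fun e => inferInstanceAs (Finite (D.XE e))⟩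

/-- The trivialising covering of the same approximator splits the glued covering at every point
(its stabilisers are the kernels of `Π_c → Π'_c`, through which the glued covering's actions
factor). [cite: MochizukiSemiAnbd2006, Def 3.5(ii) p.37] -/
theorem trivCov_splitsAt_cov {M : ℕ} (hM : 0 < M) (hdvd : ∀ w, Nat.card (A.FV w) ∣ M)
    (q : D.cov.Point) : (A.trivCov hM hdvd).SplitsAt D.cov q := by
  rcases q with ⟨w, s⟩ | ⟨e, s⟩
  · intro x γ hx
    change D.XV w at s
    change (A.πV w γ * x.1, x.2) = x at hx
    change A.πV w γ • s = s
    rw [Prod.ext_iff, and_iff_left rfl] at hx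
    rw [mul_eq_right.mp hx, one_smul]
  · intro x γ hx
    change D.XE e at s
    change (A.πE e γ * x.1, x.2) = x at hx
    change A.πE e γ • s = s
    rw [Prod.ext_iff, and_iff_left rfl] at hx
    rw [mul_eq_right.mp hx, one_smul]

/-- **The glued covering is tempered** (indeed finite étale): it is split, at every point, by the
trivialising covering of the approximator. [cite: MochizukiSemiAnbd2006, Def 3.5(ii) p.37] -/
theorem cov_isTempered : D.cov.IsTempered := fun _ => by
  obtain ⟨M, hM, hdvd⟩ := A.bounded
  exact ⟨A.trivCov hM hdvd, A.trivCov_isFinite hM hdvd, A.trivCov_hasNonemptyFibres hM hdvd,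
    fun q _ => D.trivCov_splitsAt_cov hM hdvd q⟩

/-- The glued covering as an object of `B^temp(G)`. [cite: MochizukiSemiAnbd2006, Def 3.5(ii) p.37] -/
noncomputable def tcov : BTempCat 𝒢 := ⟨D.cov, D.cov_isTempered⟩

/-- The `v`-constituent of the glued tempered covering, unfolded. [cite: MochizukiSemiAnbd2006, Prop 2.6 p.28] -/
theorem tcov_ρ (w : 𝒢.graph.Vertex) (γ : 𝒢.Gv w) (x : D.XV w) :
    (D.tcov.obj.SV w).obj.ρ γ x = A.πV w γ • x := rfl

end GluingData

end Approximator

end ProfiniteSemiGraph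

end Literature.AnabelianGeometry.SemiGraphs
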